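import Mathlib.Algebra.FreeAlgebra
import Literature.Computability.AlgebraicComplexity.ValiantConjectureEquivProofs
import Summits.ValiantsHypothesis.ValiantsHypothesis.Theses.DecompCycle1
import HarnessLib

/-!
# CommutativityDial — the noncommutative (ordered) permanent and the `VP ≠ VNP` split
`S ⟺ PerNotNcVP ∧ NcLift` (decomposition workshop `decomp-valiant`, lens 6 «restricted-models
lifting axis», gen 4; supports `DecompCycle1.PerNotSmVP`, stmt-ValiantsHypothesis-23661)

The one restricted model of the lens brief not used by gens 0–3 (tame / syntactically multilinear /
block threshold): Nisan's NONCOMMUTATIVE circuits. We give the tree's circuit SYNTAX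
`ArithCircuit k σ` (Bürgisser's straight-line programs) a second, NONCOMMUTATIVE semantics `ncEval`
into the free algebra `FreeAlgebra k σ` (products are ordered `List.prod`), define the ORDERED
permanent `ncPerPoly n = ∑_π X_(π 0, 0) · X_(π 1, 1) ⋯ X_(π (n-1), n-1)` (position `t` = column `t`),
and prove:

* `comm_ncEval` : the commutative image (`FreeAlgebra.lift k X`) of `ncEval P` is `P.eval` — an nc
  circuit for the ordered permanent IS a commutative circuit for `perPoly` of the same size;
  `comm_ncPerPoly : comm (ncPerPoly n) = perPoly (Fin n) k`.
* PIECES. `PerNotNcVP` (`A_nc`): the ordered permanent has no polynomial-size fan-in-two nc circuits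
  over `ℂ` (i.o. form, as `PerNotSmVP`); `NcLift` (`B_nc`): `VP_ℂ = VNP_ℂ ⟹` it has them.
* `closes : PerNotNcVP → NcLift → ValiantsHypothesis`; `perNotNcVP_of_vh : S → A_nc` (commutative
  image, kernel); `ncLift_of_vh` (vacuous); `ncLift_iff_residual : B_nc ↔ (A_nc → S)`;
  `summit_iff_split : S ↔ A_nc ∧ B_nc` — an exact conjunct split whose unconditional conjunct is
  S-IMPLIED and NOT KNOWN TO IMPLY S ("such a reduction is not known in the commutative case",
  Hrubeš–Wigderson–Yehudayoff 2010, remark after Thm 1.11).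
* EDGE to the gen-2 crux (hypothesis `hT` of §5, typed inline; PROVABLE-NOW, not proved here) =
  HWY10 Thm F.1 (an nc circuit of size `s` for an ordered degree-`r` polynomial gives an ORDERED,
  hence syntactically multilinear, commutative circuit of size `O(r³ s)`); under it
  `PerNotSmVP ⟹ PerNotNcVP` (`perNotNcVP_of_perNotSmVP`) and `NcLift ⟹` the sm disjunct of
  `TameOrSmLift` (`smLiftPer_of_ncLift`): the nc residual is STRONGER than the gen-2 residual
  (honest anti-descent on the residual side), the nc hardness conjunct WEAKER than `PerNotSmVP`.

HONEST FRAMING: nothing here is evidence for `VP ≠ VNP`. `A_nc` is a named open problem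
(superpolynomial lower bounds for general noncommutative circuits; equivalently, by the
noncommutative VNP-completeness of the permanent, `VP_nc ≠ VNP_nc` for circuits), `B_nc` is its
exact residual. The content is the typed dial COMMUTATIVE ⊋ SYNTACTICALLY MULTILINEAR ⊋ ORDERED
(= NONCOMMUTATIVE) ⊋ ORDERED ABP, on which the bottom rung is DECIDED (Nisan 1991: width exactly
`C(n,⌊n/2⌋)`, companion file `NisanPermanent`) and the top rung is the summit.

## References

* [HrubesWigdersonYehudayoff2011] P. Hrubeš, A. Wigderson, A. Yehudayoff, *Non-commutative circuits
  and the sum-of-squares problem*, STOC 2010 / J. AMS 24 (2011), Thm 1.7, Thm 1.11, Thm F.1.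
* [HrubesWigdersonYehudayoff2010] P. Hrubeš, A. Wigderson, A. Yehudayoff, *Relationless completeness
  and separations*, CCC 2010 (noncommutative VNP-completeness of the permanent).
* [Nisan1991Noncommutative] N. Nisan, *Lower bounds for non-commutative computation*, STOC 1991, Thm 1.
* [LimayeMalodSrinivasan2016] N. Limaye, G. Malod, S. Srinivasan, Theory Comput. 12 (2016) (nc skew
  circuits).
* [CarmosinoImpagliazzoLovettMihajlin2018] M. Carmosino, R. Impagliazzo, S. Lovett, I. Mihajlin,
  CCC 2018 (hardness amplification for nc circuits).
* [HrubesYehudayoff2011] P. Hrubeš, A. Yehudayoff, ICALP 2011 (tree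
  `Literature.Barriers.ValiantsHypothesis.NoncommutativeExtensions`), Thm 3.2 / Cor 3.3.
* [Burgisser2000] P. Bürgisser, *Completeness and Reduction in Algebraic Complexity Theory*, Def. 2.1,
  Rem. 2.11.
-/

noncomputable section

namespace Summit.ValiantsHypothesis.ValiantsHypothesis.Theorems.CommutativityDial

open Literature.Computability.AlgebraicComplexity
open Summit.ValiantsHypothesis.ValiantsHypothesis.Theses.DecompCycle1 (PerNotSmVP TameOrSmLift)
open MvPolynomial

universe u v

variable {k : Type u} {σ : Type v} [CommSemiring k]

/-! ## §1 Noncommutative semantics of the tree's circuit syntax -/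

/-- Noncommutative value of an operand against the list of nc values of the earlier gates:
`var i ↦ X i` (free generator), `const c ↦ c · 1`, `gate j ↦ vals[j]` (junk `0` out of range), exactly
as `ArithCircuit.Operand.eval` but in the free algebra (Nisan 1991 §1; HWY10 §2 "non-commutative
circuits"). [cite: Nisan1991Noncommutative, §1] -/
def ncOperandEval (vals : List (FreeAlgebra k σ)) : ArithCircuit.Operand k σ → FreeAlgebra k σ
  | .var i => FreeAlgebra.ι k i
  | .const c => algebraMap k (FreeAlgebra k σ) c
  | .gate j => vals.getD j 0

/-- Noncommutative value of a gate: weighted sum, resp. ORDERED product of its operands (the operand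
list order is the multiplication order). [cite: Nisan1991Noncommutative, §1] -/
def ncGateEval (vals : List (FreeAlgebra k σ)) : ArithCircuit.Gate k σ → FreeAlgebra k σ
  | .sum args => (args.map fun a => a.1 • ncOperandEval vals a.2).sum
  | .prod args => (args.map fun u => ncOperandEval vals u).prod

/-- The list of nc values of a gate list (left fold, as `ArithCircuit.gateValues`). [cite: Nisan1991Noncommutative, §1] -/
def ncGateValues (gs : List (ArithCircuit.Gate k σ)) : List (FreeAlgebra k σ) :=
  gs.foldl (fun vals g => vals ++ [ncGateEval vals g]) []

/-- The NONCOMMUTATIVE polynomial computed by a circuit: the same syntax (`ArithCircuit k σ`, size =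
number of gates, `IsFanInTwo` as in the tree) read in the free algebra `FreeAlgebra k σ`.
[cite: Nisan1991Noncommutative, §1] -/
def ncEval (P : ArithCircuit k σ) : FreeAlgebra k σ :=
  ncOperandEval (ncGateValues P.gates) P.output

/-- The commutative image `FreeAlgebra k σ →ₐ[k] MvPolynomial σ k`, `X i ↦ X i`. [folklore] -/
def comm : FreeAlgebra k σ →ₐ[k] MvPolynomial σ k :=
  FreeAlgebra.lift k fun i => (X i : MvPolynomial σ k)

/-- `comm (X i) = X i`. [folklore] -/
@[simp] theorem comm_ι (i : σ) : comm (FreeAlgebra.ι k i) = (X i : MvPolynomial σ k) := by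
  simp [comm]

/-- One step of the fold defining `ncGateValues`. [folklore] -/
@[simp] theorem ncGateValues_append_singleton (gs : List (ArithCircuit.Gate k σ))
    (g : ArithCircuit.Gate k σ) :
    ncGateValues (gs ++ [g]) = ncGateValues gs ++ [ncGateEval (ncGateValues gs) g] := by
  simp [ncGateValues, List.foldl_append]

/-- The commutative image of an operand's nc value is its commutative value. [folklore] -/
theorem comm_ncOperandEval (vals : List (FreeAlgebra k σ)) (u : ArithCircuit.Operand k σ) :
    comm (ncOperandEval vals u) = u.eval (vals.map comm) := by
  cases u with
  | var i => simp [ncOperandEval, ArithCircuit.Operand.eval]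
  | const c => simp [ncOperandEval, ArithCircuit.Operand.eval, AlgHom.commutes, MvPolynomial.algebraMap_eq]
  | gate j =>
    simp only [ncOperandEval, ArithCircuit.Operand.eval_gate]
    rw [← map_zero (comm (k := k) (σ := σ)), List.getD_map]

/-- The commutative image of a gate's nc value is its commutative value. [folklore] -/
theorem comm_ncGateEval (vals : List (FreeAlgebra k σ)) (g : ArithCircuit.Gate k σ) :
    comm (ncGateEval vals g) = g.eval (vals.map comm) := by
  cases g with
  | sum args =>
    simp [ncGateEval, ArithCircuit.Gate.eval, map_list_sum, List.map_map, Function.comp_def,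
      comm_ncOperandEval]
  | prod args =>
    simp [ncGateEval, ArithCircuit.Gate.eval, map_list_prod, List.map_map, Function.comp_def,
      comm_ncOperandEval]

/-- The commutative images of the nc gate values are the commutative gate values. [folklore] -/
theorem map_comm_ncGateValues (gs : List (ArithCircuit.Gate k σ)) :
    (ncGateValues gs).map comm = ArithCircuit.gateValues gs := by
  induction gs using List.reverseRecOn with
  | nil => simp [ncGateValues, ArithCircuit.gateValues]
  | append_singleton gs g ih =>
    rw [ncGateValues_append_singleton, ArithCircuit.gateValues_append_singleton, List.map_append,
      List.map_singleton, comm_ncGateEval, ih]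

/-- COMMUTATIVE IMAGE LEMMA: reading a circuit noncommutatively and then letting the variables
commute gives the polynomial it computes commutatively — so an nc circuit computing the ordered
permanent is, verbatim, a commutative circuit of the same size computing `per`. (HWY10 §1: "any lower
bound for commutative circuits is a lower bound for non-commutative circuits".)
[cite: HrubesWigdersonYehudayoff2011, §1.1] -/
theorem comm_ncEval (P : ArithCircuit k σ) : comm (ncEval P) = P.eval := by
  rw [ncEval, comm_ncOperandEval, map_comm_ncGateValues]
  rfl

/-! ## §2 The ordered (noncommutative) permanent -/

/-- The ORDERED PERMANENT `∑_π X_(π 0,0) X_(π 1,1) ⋯ X_(π (n-1),n-1)` in the free algebra on the `n²`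
matrix positions: the `t`-th factor is the variable of COLUMN `t` (the tree's `perPoly` convention
`∏ᵢ X_(π i, i)`; HWY10's row-ordered `PERM_n` is its image under the transpose relabelling, a
size-preserving automorphism). [cite: HrubesWigdersonYehudayoff2011, §1.3 eq. PERM_n] -/
def ncPerPoly (n : ℕ) : FreeAlgebra k (Fin n × Fin n) :=
  ∑ π : Equiv.Perm (Fin n), (List.ofFn fun i : Fin n => FreeAlgebra.ι k (π i, i)).prod

/-- The commutative image of the ordered permanent is the permanent. [folklore] -/
theorem comm_ncPerPoly (n : ℕ) : comm (ncPerPoly (k := k) n) = perPoly (Fin n) k := by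
  simp [ncPerPoly, map_sum, map_list_prod, List.prod_ofFn, perPoly, Matrix.permanent,
    Matrix.mvPolynomialX]

/-- An nc circuit computing the ordered permanent computes `perPoly` commutatively. [folklore] -/
theorem computes_perPoly_of_ncEval {n : ℕ} {P : ArithCircuit k (Fin n × Fin n)}
    (h : ncEval P = ncPerPoly n) : P.Computes (perPoly (Fin n) k) := by
  rw [ArithCircuit.Computes, ← comm_ncEval, h, comm_ncPerPoly]

/-! ## §3 Pieces -/

/-- PIECE `A_nc` — THE PERMANENT HAS NO POLYNOMIAL-SIZE NONCOMMUTATIVE CIRCUITS (i.o. form, over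
`ℂ`): for every exponent `c` there is an `n` such that every fan-in-two circuit whose noncommutative
value is the ordered permanent `ncPerPoly n` has more than `n^c + c` gates.
TAG: WEAKER·NECESSARY — `S ⟹ A_nc` is `perNotNcVP_of_vh` (an nc circuit for the ordered permanent
is a commutative circuit for `per`); `A_nc ⟹ S` is NOT KNOWN (HWY10, after Thm 1.11: the reduction
nc-lower-bound ⟸ multilinear-lower-bound of Thm F.1 "is not known in the commutative case").
`PerNotSmVP ⟹ A_nc` under HWY10 Thm F.1 (`perNotNcVP_of_perNotSmVP`). STATUS: OPEN PROBLEM — no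
superpolynomial lower bound is known for general noncommutative circuits computing any explicit
polynomial (HWY10 §1.1); by the noncommutative VNP-completeness of the permanent
(Hrubeš–Wigderson–Yehudayoff, *Relationless completeness*, CCC 2010) it is the circuit form of
`VP_nc ≠ VNP_nc`. LADDER (proved rungs): ordered ABPs need width exactly `C(n,⌊n/2⌋)` (Nisan 1991,
kernel `Theorems.NisanPermanent`); nc formulas exponential (Nisan 1991); nc skew circuits
exponential (Limaye–Malod–Srinivasan 2016). ROAD: `B(SOS_k) ≥ Ω(k^(1+ε))` for the bilinear
complexity of `(x₁²+⋯+x_k²)(y₁²+⋯+y_k²)` over `ℂ` ⟹ `PERM_n` needs nc circuits of size `2^Ω(n)`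
(HWY10 Thm 1.7; integer version `S_ℤ(k) ≥ Ω(k^(6/5))` proved, Thm 1.10); MAGNIFICATION: mildly
superlinear nc-circuit lower bounds for explicit constant-degree polynomials already imply
exponential ones (Carmosino–Impagliazzo–Lovett–Mihajlin 2018). BARRIER PLACEMENT: outside
the extension-robust class of `Literature.Barriers.ValiantsHypothesis.NoncommutativeExtensions`
(HY11 Thm 3.2/Cor 3.3: an argument valid over every noncommutative extension ring proves `≤ O(dn)`)
iff it uses the commutation of coefficients with variables, as Nisan's rank argument does.
[cite: HrubesWigdersonYehudayoff2011, Thm 1.7, Thm 1.11; Nisan1991Noncommutative, Thm 1; HrubesWigdersonYehudayoff2010, Thm 1; LimayeMalodSrinivasan2016, Thm 1; CarmosinoImpagliazzoLovettMihajlin2018, Thm 1] -/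
@[conjecture] def PerNotNcVP : Prop :=
  ∀ c : ℕ, ∃ n : ℕ, ∀ P : ArithCircuit ℂ (Fin n × Fin n), P.IsFanInTwo →
    ncEval P = ncPerPoly n → n ^ c + c < P.size

/-- PIECE `B_nc` — THE NONCOMMUTATIVE LIFTING RESIDUAL: if `VP_ℂ = VNP_ℂ` then the ordered permanent
has fan-in-two noncommutative circuits of polynomial size. TAG: DECLARED-RESIDUAL · WEAKER (vacuous
under `S`, `ncLift_of_vh`) · EXACT (`ncLift_iff_residual : B_nc ↔ (A_nc → S)`) · IDEA-NEEDED: no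
mechanism is known that re-orders a commutative circuit for `per` at polynomial cost (the best
known passage commutative → syntactically multilinear costs `2^r`, HWY10 proof of Thm F.1 remark;
the gen-3 block-Laplace mechanism gives sm circuits of size `4^(n/c)·poly`, not ordered ones).
STRONGER than the gen-2 residual's sm disjunct under HWY10 Thm F.1 (`smLiftPer_of_ncLift`).
STATED TEST: `B_nc` fails iff `A_nc ∧ ¬S`; cheapest informative check — none finite (asymptotic);
structural test: exhibit any p-family in `VP` whose ordered version provably needs superpolynomial
nc circuits (none is known, HWY10 §1.1). [cite: HrubesWigdersonYehudayoff2011, Thm F.1] -/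
@[conjecture] def NcLift : Prop :=
  VP ℂ = VNP ℂ → ∃ c : ℕ, ∀ n : ℕ, ∃ P : ArithCircuit ℂ (Fin n × Fin n), P.IsFanInTwo ∧
    ncEval P = ncPerPoly n ∧ P.size ≤ n ^ c + c

/-! ## §4 Deciding theorems -/

/-- NODE: `S ⟸ A_nc ∧ B_nc` (a.e./i.o. clash at the polynomial threshold). [folklore] -/
theorem closes (hA : PerNotNcVP) (hB : NcLift) : _root_.ValiantsHypothesis := by
  intro heq
  obtain ⟨c, hc⟩ := hB heq
  obtain ⟨n, hn⟩ := hA c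
  obtain ⟨P, h2, hP, hs⟩ := hc n
  exact absurd hs (not_le_of_gt (hn P h2 hP))

/-- NECESSITY of `A_nc` (kernel): `S ⟹ A_nc`, because an nc circuit for the ordered permanent is a
commutative circuit for `per` of the same size (`computes_perPoly_of_ncEval`,
`ArithCircuit.complexity_le_size`) and `S` says `per` is not p-computable
(`perNotPComputableComplex_iff_holds`). [folklore] -/
theorem perNotNcVP_of_vh (hS : _root_.ValiantsHypothesis) : PerNotNcVP := by
  intro c
  have hS' := perNotPComputableComplex_iff_holds.mpr hS
  by_contra h
  simp only [not_exists, not_forall, not_lt] at h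
  apply hS'
  refine ⟨c, fun n => ?_⟩
  obtain ⟨P, hfan, hcomp, hsize⟩ := h n
  exact (ArithCircuit.complexity_le_size hfan (computes_perPoly_of_ncEval hcomp)).trans hsize

/-- `B_nc` is (vacuously) implied by `S`. [folklore] -/
theorem ncLift_of_vh (hS : _root_.ValiantsHypothesis) : NcLift := fun heq => absurd heq hS

/-- `B_nc` is EXACTLY the residual of `A_nc`. [folklore] -/
theorem ncLift_iff_residual : NcLift ↔ (PerNotNcVP → _root_.ValiantsHypothesis) := by
  refine ⟨fun hB hA => closes hA hB, fun h heq => ?_⟩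
  have hA : ¬ PerNotNcVP := fun hA => h hA heq
  simp only [PerNotNcVP, not_forall, not_exists, not_lt, exists_prop] at hA
  exact hA

/-- THE NODE IS AN EXACT CONJUNCT SPLIT: `S ⟺ A_nc ∧ B_nc`. [folklore] -/
theorem summit_iff_split : _root_.ValiantsHypothesis ↔ PerNotNcVP ∧ NcLift :=
  ⟨fun hS => ⟨perNotNcVP_of_vh hS, ncLift_of_vh hS⟩, fun h => closes h.1 h.2⟩

/-! ## §5 Comparison with the gen-2 pieces under the typed HWY10 transfer

The hypothesis `hT` of the three comparison theorems is Hrubeš–Wigderson–Yehudayoff 2010, Thm 1.11 /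
Thm F.1, specialised to the permanent and typed in the tree's model (THEOREM IN PRINT, not yet
proved in the tree; stated inline, not as a named fact): a fan-in-two nc circuit of size `s` for the
ordered permanent yields a fan-in-two SYNTACTICALLY MULTILINEAR commutative circuit for `per_n` of
size `≤ 64 (n+1)^4 (s+1)` (HWY: gates `(v,[j,k])`, `[j,k]` an interval of positions, `O(r³ s)` of
them for degree `r = n`; an ordered circuit is syntactically multilinear in the column blocks; the
constant is a generous typing of `O(n³)`). -/

/-- The transfer overhead `64 (n+1)^4 (n^c + c + 1)` is p-bounded. [folklore] -/
theorem isPBounded_transferBound (c : ℕ) :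
    IsPBounded fun n => 64 * (n + 1) ^ 4 * (n ^ c + c + 1) := by
  refine (IsPBounded.iff_exists_le_mul_succ_pow _).2 ⟨64 * (c + 2), c + 4, fun n => ?_⟩
  have h1 : n ^ c ≤ (n + 1) ^ c := Nat.pow_le_pow_left (Nat.le_succ n) c
  have h2 : 1 ≤ (n + 1) ^ c := Nat.one_le_pow _ _ (Nat.succ_pos n)
  have h3 : n ^ c + c + 1 ≤ (c + 2) * (n + 1) ^ c := by nlinarith
  calc 64 * (n + 1) ^ 4 * (n ^ c + c + 1) ≤ 64 * (n + 1) ^ 4 * ((c + 2) * (n + 1) ^ c) :=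
        Nat.mul_le_mul_left _ h3
    _ = 64 * (c + 2) * (n + 1) ^ (c + 4) := by ring

/-- EDGE `PerNotSmVP ⟹ A_nc` (the gen-2 crux stmt-ValiantsHypothesis-23661 implies the nc hardness
conjunct) under the typed HWY10 transfer: the nc conjunct is the WEAKER end of the dial
`sm ⊋ ordered = nc`. [cite: HrubesWigdersonYehudayoff2011, Thm 1.11] -/
theorem perNotNcVP_of_perNotSmVP
    (hT : ∀ (n : ℕ) (P : ArithCircuit ℂ (Fin n × Fin n)), P.IsFanInTwo → ncEval P = ncPerPoly n →
      ∃ Q : ArithCircuit ℂ (Fin n × Fin n), Q.IsFanInTwo ∧ IsSyntacticallyMultilinear Q ∧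
        Q.Computes (perPoly (Fin n) ℂ) ∧ Q.size ≤ 64 * (n + 1) ^ 4 * (P.size + 1))
    (hA : PerNotSmVP) : PerNotNcVP := by
  intro c
  obtain ⟨c', hc'⟩ := isPBounded_transferBound c
  obtain ⟨n, hn⟩ := hA c'
  refine ⟨n, fun P h2 hP => ?_⟩
  by_contra hs
  rw [not_lt] at hs
  obtain ⟨Q, hQ2, hQsm, hQf, hQs⟩ := hT n P h2 hP
  have hlt := hn Q hQ2 hQsm hQf
  have hle : Q.size ≤ n ^ c' + c' :=
    hQs.trans ((Nat.mul_le_mul_left _ (Nat.succ_le_succ hs)).trans (hc' n))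
  exact absurd hle (not_le_of_gt hlt)

/-- EDGE `B_nc ⟹ SmLiftPer` (the sm disjunct of the gen-2 residual `TameOrSmLift`,
stmt-ValiantsHypothesis-23662) under the typed HWY10 transfer: the nc residual is the STRONGER one
(honest anti-descent on the residual side of the dial). [cite: HrubesWigdersonYehudayoff2011, Thm 1.11] -/
theorem smLiftPer_of_ncLift
    (hT : ∀ (n : ℕ) (P : ArithCircuit ℂ (Fin n × Fin n)), P.IsFanInTwo → ncEval P = ncPerPoly n →
      ∃ Q : ArithCircuit ℂ (Fin n × Fin n), Q.IsFanInTwo ∧ IsSyntacticallyMultilinear Q ∧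
        Q.Computes (perPoly (Fin n) ℂ) ∧ Q.size ≤ 64 * (n + 1) ^ 4 * (P.size + 1))
    (hB : NcLift) (heq : VP ℂ = VNP ℂ) :
    ∃ c : ℕ, ∀ n : ℕ, ∃ P : ArithCircuit ℂ (Fin n × Fin n), P.IsFanInTwo ∧
      IsSyntacticallyMultilinear P ∧ P.Computes (perPoly (Fin n) ℂ) ∧ P.size ≤ n ^ c + c := by
  obtain ⟨c, hc⟩ := hB heq
  obtain ⟨c', hc'⟩ := isPBounded_transferBound c
  refine ⟨c', fun n => ?_⟩
  obtain ⟨P, h2, hP, hs⟩ := hc n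
  obtain ⟨Q, hQ2, hQsm, hQf, hQs⟩ := hT n P h2 hP
  exact ⟨Q, hQ2, hQsm, hQf,
    hQs.trans ((Nat.mul_le_mul_left _ (Nat.succ_le_succ hs)).trans (hc' n))⟩

/-- Hence `B_nc ⟹ TameOrSmLift` (the registered gen-2 residual, stmt-ValiantsHypothesis-23662) under
the typed HWY10 transfer. [cite: HrubesWigdersonYehudayoff2011, Thm 1.11] -/
theorem tameOrSmLift_of_ncLift
    (hT : ∀ (n : ℕ) (P : ArithCircuit ℂ (Fin n × Fin n)), P.IsFanInTwo → ncEval P = ncPerPoly n →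
      ∃ Q : ArithCircuit ℂ (Fin n × Fin n), Q.IsFanInTwo ∧ IsSyntacticallyMultilinear Q ∧
        Q.Computes (perPoly (Fin n) ℂ) ∧ Q.size ≤ 64 * (n + 1) ^ 4 * (P.size + 1))
    (hB : NcLift) : TameOrSmLift := fun heq =>
  Or.inr (smLiftPer_of_ncLift hT hB heq)

end Summit.ValiantsHypothesis.ValiantsHypothesis.Theorems.CommutativityDial
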